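import Mathlib
import HarnessLib

/-!
# The Weinstein–Aronszajn criterion for a finite-rank modification of a linear pencil (`WeinsteinAronszajnPencil`)

CITATION HEADER (lean-in-tree rule 2026-08-18; reproduction of a published result, abstract form). T. Kato, *Perturbation
theory for linear operators*, Grundlehren math. Wiss. 132, Springer 1966 [Kato1966], Chapter IV §6 "Degenerate
perturbations": §6.1 pp. 244–245, eqs. (6.1)–(6.4) — for an (absolutely) degenerate perturbation `A u = Σ_j (u, e_j) x_j` of a
closed operator `T` and `ζ ∈ P(T)`, the W–A determinant of the first kind
`ω(ζ; T, A) = det(1 + A(T − ζ)⁻¹) = det(δ_jk + (R(ζ) x_j, e_k))`, `R(ζ) = (T − ζ)⁻¹`; §6.2 Theorem 6.2 p. 247 (first W–A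
formula `ν̃(ζ; T + A) = ν̃(ζ; T) + ν(ζ; ω)`), whose zero-order content is: for `ζ ∈ P(T)`, `ζ` is an eigenvalue of `T + A`
iff `ω(ζ) = 0`.
WHAT IS REPRODUCED: exactly that zero-order content ("eigenvalue iff the finite W–A matrix is singular", both directions,
with the explicit eigenvector `R(ζ)(Σ c_j x_j)`), kernel-checked from first principles in the following ABSTRACT PENCIL FORM,
which is the form computer-assisted spectral arguments use: `𝕜` any field; `V` ("the domain") and `E` ("the space")
`𝕜`-modules; a pencil `L, J : V →ₗ[𝕜] E` (Kato: `T` and the inclusion `D(T) ↪ X`); finitely many vectors `w : ι → E`,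
functionals `g : ι → E →ₗ[𝕜] 𝕜` and a coefficient matrix `S : Matrix ι ι 𝕜`, giving the finite-rank operator
`lift w g S : x ↦ Σ_i (S (g_k x)_k)_i • w_i` (Kato's `−A`, `x_j = −Σ_i S_ij w_i`, `e_k = g_k`); the MODIFIED PENCIL
`pencilMod L J w g S z = L − z • J + lift w g S ∘ J : V →ₗ E` (Kato's unperturbed `T − ζ`, which here may itself depend
on `z` — therefore only the zero-set statement is reproduced, NOT the multiplicity formula (6.16)); an INVERSE DATUM
`R : E →ₗ[𝕜] V` for it (Kato's `R(ζ)`; right-inverse half `hR₁ : ∀ x, G (R x) = x`, left-inverse half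
`hR₂ : ∀ u, R (G u) = u`, kept separate because each direction uses one); and the W–A MATRIX
`waMatrix J R w g = (g_k (J (R w_l)))_kl` (Kato's `((R(ζ) x_j, e_k))` up to the factor `−S`), so that
`ω ↔ det(1 − waMatrix · S)`.
NEAREST IN-TREE RESULT and why it does not cover this: `Literature.MathematicalPhysics.KineticTheory.hasEigenvector_perturb_iff`
(SeparableTwoBodyTMatrix.lean §3) is the same principle for a BOUNDED `M : H →L[ℂ] H` on a complex Hilbert space with
Mathlib's `resolvent M z`; the pencil form below has an unbounded-operator domain `V ≠ E`, arbitrary scalars, and an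
inverse datum supplied as a hypothesis (in applications: by a certified coercivity estimate), none of which that file allows.

CONTENTS (sorry-free, axioms standard; every step is elementary algebra once the objects are Kato's):
* objects: `waMatrix`, `lift`, `pencilMod`; `g_comp_sum_eq_waMatrix_mulVec` — `(g_k (J R (Σ_l a_l • w_l)))_k = T a`.
* **`det_eq_zero_of_eigenvector`** (`u ≠ 0`, `L u = z • J u`, `R` a LEFT inverse ⇒ `det(1 − T S) = 0`);
  **`exists_eigenvector_of_det_eq_zero`** (`det(1 − T S) = 0`, `R` a RIGHT inverse ⇒ `∃ u ≠ 0, L u = z • J u`, namely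
  `u = R(Σ (S c)_l • w_l)`; `u ≠ 0` is automatic because `g (J u) = c ≠ 0` — no injectivity of `a ↦ Σ a_l • w_l` and no
  independence of the `g_k` is needed in either direction); `exists_eigenvector_iff_det_eq_zero`.
USED BY (honest framing): audit cell `pub-nsjs` (papers/NavierStokesRegularity/ns-jia-sverak), seat B gen 15 — this file is
the kernel form of that cell's paper-level "LEMMA R" (GAP-v11 §5 G2, residual R-b; DET2D-HYPOTHESES H2–H3), with the
dictionary `V = dom(𝓛) ∩ anti2`, `E` = weighted `L²|anti2`, `L = 𝓛_Ũ`, `J` = inclusion,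
`w_l = ψ_l`, `g_k = ⟨ψ_k, ·⟩`, `S = S′`, `R = G_z⁻¹` (whose existence, LEMMA C′, stays a hypothesis there). The file asserts
NOTHING about that operator, its spectrum, or Navier–Stokes; it is pure linear algebra.
-/

open scoped BigOperators Matrix

namespace Literature.Analysis.OperatorTheory

namespace WeinsteinAronszajnPencil

section Algebra

variable {𝕜 : Type*} [Field 𝕜]
variable {V E : Type*} [AddCommGroup V] [Module 𝕜 V] [AddCommGroup E] [Module 𝕜 E]
variable {ι : Type*}

/-- The Weinstein–Aronszajn matrix `T_{kl} = g_k (J (R w_l))` of the modification, `R` an inverse datum for `G_z`.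
[cite: Kato1966, IV-§6.1 (6.4) p.245] -/
def waMatrix (J : V →ₗ[𝕜] E) (R : E →ₗ[𝕜] V) (w : ι → E) (g : ι → E →ₗ[𝕜] 𝕜) : Matrix ι ι 𝕜 :=
  Matrix.of fun k l => g k (J (R (w l)))

/-- Entries of the W–A matrix (Kato's `((R(ζ) x_j, e_k))`). [cite: Kato1966, IV-§6.1 (6.4) p.245] -/
@[simp] lemma waMatrix_apply (J : V →ₗ[𝕜] E) (R : E →ₗ[𝕜] V) (w : ι → E) (g : ι → E →ₗ[𝕜] 𝕜) (k l : ι) :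
    waMatrix J R w g k l = g k (J (R (w l))) := rfl

variable [Fintype ι]

/-- The finite-rank operator `x ↦ ∑ i, (S *ᵥ (k ↦ g k x)) i • w i` (Kato's `−A`, (6.2)). [cite: Kato1966, IV-§6.1 (6.2) p.245] -/
def lift (w : ι → E) (g : ι → E →ₗ[𝕜] 𝕜) (S : Matrix ι ι 𝕜) : E →ₗ[𝕜] E where
  toFun x := ∑ i, (S *ᵥ fun j => g j x) i • w i
  map_add' x y := by
    have h : (fun j => g j (x + y)) = (fun j => g j x) + fun j => g j y := by
      funext j; simp
    simp only [h, Matrix.mulVec_add, Pi.add_apply, add_smul, Finset.sum_add_distrib]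
  map_smul' c x := by
    have h : (fun j => g j (c • x)) = c • fun j => g j x := by
      funext j; simp
    simp only [h, Matrix.mulVec_smul, Pi.smul_apply, smul_eq_mul, mul_smul, Finset.smul_sum,
      RingHom.id_apply]

/-- Pointwise formula for `lift` (Kato's `A u = Σ (u, e_j) x_j`). [cite: Kato1966, IV-§6.1 (6.2) p.245] -/
@[simp] lemma lift_apply (w : ι → E) (g : ι → E →ₗ[𝕜] 𝕜) (S : Matrix ι ι 𝕜) (x : E) :
    lift w g S x = ∑ i, (S *ᵥ fun j => g j x) i • w i := rfl

/-- The modified pencil `G_z = L - z J + (lift w g S) ∘ J : V →ₗ E` (Kato's `T − ζ`). [cite: Kato1966, IV-§6.1 (6.1) p.244] -/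
def pencilMod (L J : V →ₗ[𝕜] E) (w : ι → E) (g : ι → E →ₗ[𝕜] 𝕜) (S : Matrix ι ι 𝕜) (z : 𝕜) :
    V →ₗ[𝕜] E :=
  L - z • J + lift w g S ∘ₗ J

/-- Pointwise formula for `pencilMod` (Kato's `T + A − ζ` applied to a domain vector). [cite: Kato1966, IV-§6.1 (6.1) p.244] -/
lemma pencilMod_apply (L J : V →ₗ[𝕜] E) (w : ι → E) (g : ι → E →ₗ[𝕜] 𝕜) (S : Matrix ι ι 𝕜) (z : 𝕜)
    (u : V) :
    pencilMod L J w g S z u = L u - z • J u + ∑ i, (S *ᵥ fun j => g j (J u)) i • w i := rfl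

/-- The functionals applied to `J R` of a combination of the `w l` give the W–A matrix acting on the coefficient
vector: `(g k (J (R (∑ l, a l • w l))))_k = T *ᵥ a` (Kato's (6.3): `A R(ζ) u = Σ (R(ζ) u, e_i) x_i`).
[cite: Kato1966, IV-§6.1 (6.3) p.245] -/
lemma g_comp_sum_eq_waMatrix_mulVec (J : V →ₗ[𝕜] E) (R : E →ₗ[𝕜] V) (w : ι → E) (g : ι → E →ₗ[𝕜] 𝕜)
    (a : ι → 𝕜) :
    (fun k => g k (J (R (∑ l, a l • w l)))) = waMatrix J R w g *ᵥ a := by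
  funext k
  simp only [map_sum, map_smul, smul_eq_mul, Matrix.mulVec, dotProduct, waMatrix_apply]
  exact Finset.sum_congr rfl fun l _ => mul_comm _ _

/-- **Forward direction** (Kato's "`ζ` an eigenvalue of `T + A` forces `ω(ζ) = 0`"): if `u ≠ 0` solves the pencil
equation `L u = z • J u` and `R` is a LEFT inverse of the modified pencil `G_z`, then the W–A matrix `1 - T S` is
singular. No hypothesis on the `w l` or the `g k` is needed. [cite: Kato1966, IV-§6.2 Thm 6.2 p.247] -/
theorem det_eq_zero_of_eigenvector [DecidableEq ι] (L J : V →ₗ[𝕜] E) (w : ι → E) (g : ι → E →ₗ[𝕜] 𝕜)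
    (S : Matrix ι ι 𝕜) (z : 𝕜) (R : E →ₗ[𝕜] V) (hR₂ : ∀ u, R (pencilMod L J w g S z u) = u)
    {u : V} (hu : u ≠ 0) (heig : L u = z • J u) :
    (1 - waMatrix J R w g * S).det = 0 := by
  set c : ι → 𝕜 := fun j => g j (J u) with hc_def
  have hG : pencilMod L J w g S z u = ∑ i, (S *ᵥ c) i • w i := by
    rw [pencilMod_apply, heig, sub_self, zero_add]
  have hfix : (waMatrix J R w g * S) *ᵥ c = c := by
    calc (waMatrix J R w g * S) *ᵥ c = waMatrix J R w g *ᵥ (S *ᵥ c) := (Matrix.mulVec_mulVec _ _ _).symm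
      _ = fun k => g k (J (R (∑ l, (S *ᵥ c) l • w l))) := (g_comp_sum_eq_waMatrix_mulVec J R w g _).symm
      _ = fun k => g k (J (R (pencilMod L J w g S z u))) := by rw [hG]
      _ = c := by simp_rw [hR₂]; rfl
  have hc0 : c ≠ 0 := by
    intro h0
    apply hu
    rw [← hR₂ u, hG, h0, Matrix.mulVec_zero]
    simp
  refine Matrix.exists_mulVec_eq_zero_iff.mp ⟨c, hc0, ?_⟩
  rw [Matrix.sub_mulVec, Matrix.one_mulVec, hfix, sub_self]

/-- **Backward direction** (Kato's "`ω(ζ) = 0` forces `ζ` to be an eigenvalue of `T + A`"): if the W–A matrix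
`1 - T S` is singular and `R` is a RIGHT inverse of the modified pencil `G_z`, then the pencil equation
`L u = z • J u` has a NON-ZERO solution in the domain `V`, namely `u = R (∑ l, (S c)_l • w l)` for a kernel vector `c`
of `1 - T S`. `u ≠ 0` is automatic (`g (J u) = c ≠ 0`): no injectivity of `a ↦ ∑ a l • w l` is used. [cite: Kato1966, IV-§6.2 Thm 6.2 p.247] -/
theorem exists_eigenvector_of_det_eq_zero [DecidableEq ι] (L J : V →ₗ[𝕜] E) (w : ι → E)
    (g : ι → E →ₗ[𝕜] 𝕜) (S : Matrix ι ι 𝕜) (z : 𝕜) (R : E →ₗ[𝕜] V)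
    (hR₁ : ∀ x, pencilMod L J w g S z (R x) = x) (hdet : (1 - waMatrix J R w g * S).det = 0) :
    ∃ u : V, u ≠ 0 ∧ L u = z • J u := by
  obtain ⟨c, hc0, hc⟩ := Matrix.exists_mulVec_eq_zero_iff.mpr hdet
  have hfix : waMatrix J R w g *ᵥ (S *ᵥ c) = c := by
    rw [Matrix.sub_mulVec, Matrix.one_mulVec, sub_eq_zero] at hc
    rw [Matrix.mulVec_mulVec]
    exact hc.symm
  set x : E := ∑ l, (S *ᵥ c) l • w l with hx_def
  have hgx : (fun k => g k (J (R x))) = c := by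
    rw [hx_def, g_comp_sum_eq_waMatrix_mulVec, hfix]
  refine ⟨R x, ?_, ?_⟩
  · intro h0
    apply hc0
    rw [← hgx, h0]
    funext k
    simp
  · have h1 := hR₁ x
    rw [pencilMod_apply, hgx, ← hx_def, add_eq_right, sub_eq_zero] at h1
    exact h1

/-- The two directions together, for a TWO-SIDED inverse datum `R` of `G_z`: the pencil `L - z J` has a non-trivial
kernel vector in `V` iff the W–A matrix `1 - T(z) S` is singular. [cite: Kato1966, IV-§6.2 Thm 6.2 p.247] -/
theorem exists_eigenvector_iff_det_eq_zero [DecidableEq ι] (L J : V →ₗ[𝕜] E) (w : ι → E)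
    (g : ι → E →ₗ[𝕜] 𝕜) (S : Matrix ι ι 𝕜) (z : 𝕜) (R : E →ₗ[𝕜] V)
    (hR₁ : ∀ x, pencilMod L J w g S z (R x) = x) (hR₂ : ∀ u, R (pencilMod L J w g S z u) = u) :
    (∃ u : V, u ≠ 0 ∧ L u = z • J u) ↔ (1 - waMatrix J R w g * S).det = 0 :=
  ⟨fun ⟨_, hu, heig⟩ => det_eq_zero_of_eigenvector L J w g S z R hR₂ hu heig,
    exists_eigenvector_of_det_eq_zero L J w g S z R hR₁⟩

end Algebra


end WeinsteinAronszajnPencil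

end Literature.Analysis.OperatorTheory
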